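import Summits.Ventures.CertifiedArithmetic.LowPrec.SRThresholdNecessity
import HarnessLib

/-!
# The thresholds are exact: `iff` theorems, every format, every rule

HONEST FRAMING: certified error envelopes and provably optimal rounding/accumulation schemes for
low-precision formats under stated cost models; every table by two implementations; no hardware or
vendor claims.

File XC of the SR slice — the closed-form random-bit thresholds of LXXX–LXXXIX as EQUIVALENCES in
the bit count `N`, for each of the three P3109 rules SEPARATELY (a format with `emaxCode ≥ 2`,
`topMan ≥ 1`, `bias + m ≥ 3`; `L = emaxCode − 1`, `j = bias + m − 1`):
* `tree_threshold_iff` — every summation tree with format leaves has the exact-SR law under rule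
  `A` (resp. `B`, `C`) with `N` bits **iff** `L ≤ N`;
* `ip1_threshold_iff` — every one-stage inner product (exact products of format vectors, any
  format start) has the exact-SR law under rule `A` (resp. `B`, `C`) **iff** `L + j ≤ N`;
* `prod_threshold_iff` — every exact product of two values has an `N`-bit dyadic up-probability
  **iff** `max (m+1) j ≤ N` (also `m ≥ 1` and `emaxCode + bias ≥ 4`, met by every tabulated
  format: the normal-regime witness of LXXXV is needed exactly when `bias ≤ 1`);
* `ip2_threshold_iff` — every two-stage inner product (products SR-rounded into the format first)
  has the exact-SR law under rule `A` (resp. `B`, `C`) **iff** `max L (max (m+1) j) ≤ N` (also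
  `bias ≤ emaxCode`, so that `1` is a value: `one_mem_valueSet`).
Sufficiency is `valueSet_thresholds_exact` (LXXXVI); necessity holds at EVERY `N` below the
threshold, not only one bit short: the witness states of LXXXII/LXXXIV/LXXXV have an exact
up-probability that is not an `N`-bit dyadic for any smaller `N` (`dyadic_mono`), hence a biased
one-step mean under every `N`-bit rule (LXXXVIII `stepQ_ABC_id_ne_of_not_dyadic`) — realised by
the pair tree `(−maxRat) + q`, the one-stage step `−maxRat + q·q`, and the length-one two-stage
inner products `−maxRat + q·1` and `0 + a·b` (`valueSet_pair_biased_below`,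
`valueSet_ip1_biased_below`, `valueSet_prod_not_dyadic_below`, `valueSet_ip2_biased_below`).
-/

namespace Summit.Ventures.CertifiedArithmetic.LowPrec.SR.LimitedBits

open Literature.ComputerArithmetic.P3109
open Literature.ComputerArithmetic.ConnollyHighamMary2021
open Literature.ComputerArithmetic.FloatingPoint (Format MiniFloat)
open Literature.ComputerArithmetic.FloatingPoint.MiniFloat (valueSet valueSet_nonempty)
open Summit.Ventures.CertifiedArithmetic.LowPrec.SR
open Finset STree

/-! ### `1` is a value -/

/-- A power of two `2^a · quantum` within range is a value. -/
theorem two_pow_mul_quantum_mem_valueSet (φ : Format) {a : ℕ} (ha : 2 ^ a ≤ φ.maxScaled) :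
    ((2 ^ a : ℕ) : ℚ) * φ.quantum ∈ valueSet φ :=
  MiniFloat.natMul_quantum_mem_valueSet ha
    (MiniFloat.representable_iff.mpr ⟨ha, 1, a, Nat.one_lt_two_pow_iff.mpr (by omega), by ring⟩)

/-- `1` is a value of every format with `bias ≤ emaxCode` (`emaxCode ≥ 1`, `bias + m ≥ 1`). -/
theorem one_mem_valueSet (φ : Format) (hE : 1 ≤ φ.emaxCode) (h1 : 1 ≤ φ.bias + φ.manBits)
    (hb : φ.bias ≤ φ.emaxCode) : (1 : ℚ) ∈ valueSet φ := by
  have hle : 2 ^ (φ.bias + φ.manBits - 1) ≤ φ.maxScaled := by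
    rw [Format.maxScaled_eq hE]
    calc 2 ^ (φ.bias + φ.manBits - 1) ≤ 2 ^ (φ.manBits + (φ.emaxCode - 1)) :=
          Nat.pow_le_pow_right (by norm_num) (by omega)
      _ = 2 ^ φ.manBits * 2 ^ (φ.emaxCode - 1) := pow_add _ _ _
      _ ≤ (2 ^ φ.manBits + φ.topMan) * 2 ^ (φ.emaxCode - 1) :=
          Nat.mul_le_mul_right _ (Nat.le_add_right _ _)
  have h := two_pow_mul_quantum_mem_valueSet φ hle
  have hq : ((2 ^ (φ.bias + φ.manBits - 1) : ℕ) : ℚ) * φ.quantum = 1 := by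
    rw [Format.quantum_eq_inv_two_pow h1]; push_cast
    rw [mul_one_div, div_self (by positivity)]
  rwa [hq] at h

/-! ### The witnesses are biased at EVERY bit count below the threshold -/

/-- The pair `−maxRat + q` is biased under each rule with any `N < emaxCode − 1` bits. -/
theorem valueSet_pair_biased_below (φ : Format) (hE : 2 ≤ φ.emaxCode) (ht : 1 ≤ φ.topMan) {N : ℕ}
    (hN : N < φ.emaxCode - 1) :
    stepQ (valueSet φ) (probAwayA N) (-φ.maxRat + φ.quantum) (fun t => t)
        ≠ clamp (valueSet φ) (-φ.maxRat + φ.quantum) ∧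
      stepQ (valueSet φ) (probAwayB N) (-φ.maxRat + φ.quantum) (fun t => t)
        ≠ clamp (valueSet φ) (-φ.maxRat + φ.quantum) ∧
      stepQ (valueSet φ) (probAwayC N) (-φ.maxRat + φ.quantum) (fun t => t)
        ≠ clamp (valueSet φ) (-φ.maxRat + φ.quantum) := by
  obtain ⟨-, -, hnd, -, -⟩ := valueSet_tree_budget_sharp φ hE ht
  exact stepQ_ABC_id_ne_of_not_dyadic fun h => hnd (dyadic_mono (by omega) h)

/-- The one-stage state `−maxRat + q·q` is biased under each rule with any `N < L + j` bits. -/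
theorem valueSet_ip1_biased_below (φ : Format) (hE : 2 ≤ φ.emaxCode) (ht : 1 ≤ φ.topMan)
    (h1 : 1 ≤ φ.bias + φ.manBits) {N : ℕ} (hN : N < φ.emaxCode - 1 + (φ.bias + φ.manBits - 1)) :
    stepQ (valueSet φ) (probAwayA N) (-φ.maxRat + φ.quantum * φ.quantum) (fun t => t)
        ≠ clamp (valueSet φ) (-φ.maxRat + φ.quantum * φ.quantum) ∧
      stepQ (valueSet φ) (probAwayB N) (-φ.maxRat + φ.quantum * φ.quantum) (fun t => t)
        ≠ clamp (valueSet φ) (-φ.maxRat + φ.quantum * φ.quantum) ∧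
      stepQ (valueSet φ) (probAwayC N) (-φ.maxRat + φ.quantum * φ.quantum) (fun t => t)
        ≠ clamp (valueSet φ) (-φ.maxRat + φ.quantum * φ.quantum) := by
  obtain ⟨-, -, hnd, -, -⟩ := valueSet_ip_budget_sharp φ hE ht h1
  exact stepQ_ABC_id_ne_of_not_dyadic fun h => hnd (dyadic_mono (by omega) h)

/-- Below the product threshold `max (m+1) j` some exact product of two values has a non-`N`-dyadic
up-probability: `q·q` when `N < j` (LXXXIV); the top-significand square
`(2^(m+1)−1)q · (2^(m+1)−1)q` when `j ≤ N < m + 1` — which forces `bias ≤ 1` — in binade `2 − bias`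
(LXXXV). -/
theorem valueSet_prod_not_dyadic_below (φ : Format) (hE : 2 ≤ φ.emaxCode)
    (h3 : 3 ≤ φ.bias + φ.manBits) (hm : 1 ≤ φ.manBits) (hn : 4 ≤ φ.emaxCode + φ.bias) {N : ℕ}
    (hN : N < max (φ.manBits + 1) (φ.bias + φ.manBits - 1)) :
    ∃ a ∈ valueSet φ, ∃ b ∈ valueSet φ, ¬ Dyadic N (pUp (valueSet φ) (a * b)) := by
  have hms : 1 ≤ φ.maxScaled := by
    have : 0 < (2 ^ φ.manBits + φ.topMan) * 2 ^ (φ.emaxCode - 1) := by positivity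
    rw [Format.maxScaled_eq (by omega)]; omega
  rcases Nat.lt_or_ge N (φ.bias + φ.manBits - 1) with hlt | hge
  · obtain ⟨hqm, -, hnd, -, -⟩ := valueSet_prod_law_sharp φ hms h3
    exact ⟨_, hqm, _, hqm, fun h => hnd (dyadic_mono (by omega) h)⟩
  · have hmax := lt_max_iff.mp hN
    have hb : φ.bias ≤ 1 := by omega
    have h1 : 1 ≤ φ.bias + φ.manBits := by omega
    obtain ⟨ha, hb', -, hnd, -⟩ := valueSet_prod_law_sharp_normal φ φ φ hm hm h1 h1 h1
      (M := φ.manBits + 1) (s := 2 - φ.bias) (e₁ := 0) (e₂ := 0) (by omega) (by omega)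
      (by omega) (by omega) (by omega) (by omega)
    exact ⟨_, ha, _, hb', fun h => hnd (dyadic_mono (by omega) h)⟩

/-- Two-stage inner products below the threshold `max L (max (m+1) j)`: under each rule with `N`
bits some length-one two-stage inner product of format data from a format start has a mean
different from exact SR's — `q · 1` from the start `−maxRat` when `N < L` (`1` a value:
`bias ≤ emaxCode`), the product `a · b` of `valueSet_prod_not_dyadic_below` from the start `0` when
`N < max (m+1) j`. -/
theorem valueSet_ip2_biased_below (φ : Format) (hE : 2 ≤ φ.emaxCode) (ht : 1 ≤ φ.topMan)
    (h3 : 3 ≤ φ.bias + φ.manBits) (hm : 1 ≤ φ.manBits) (hn : 4 ≤ φ.emaxCode + φ.bias)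
    (hb : φ.bias ≤ φ.emaxCode) {N : ℕ}
    (hN : N < max (φ.emaxCode - 1) (max (φ.manBits + 1) (φ.bias + φ.manBits - 1))) :
    ∃ x y : ℕ → ℚ, (∀ k, x k ∈ valueSet φ) ∧ (∀ k, y k ∈ valueSet φ) ∧ ∃ s ∈ valueSet φ,
      ipExpQ (valueSet φ) (probAwayA N) (fun k => x k * y k) 1 (fun t => t) s
          ≠ ipExp (valueSet φ) (fun k => x k * y k) 1 (fun t => t) s ∧
        ipExpQ (valueSet φ) (probAwayB N) (fun k => x k * y k) 1 (fun t => t) s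
          ≠ ipExp (valueSet φ) (fun k => x k * y k) 1 (fun t => t) s ∧
        ipExpQ (valueSet φ) (probAwayC N) (fun k => x k * y k) 1 (fun t => t) s
          ≠ ipExp (valueSet φ) (fun k => x k * y k) 1 (fun t => t) s := by
  have hne := valueSet_nonempty φ
  -- length one, exact product a VALUE `c`: one step from `s + c`
  have red : ∀ (qr : ℚ → ℚ) {c : ℚ} (s : ℚ), c ∈ valueSet φ →
      ipExpQ (valueSet φ) qr (fun _ => c) 1 (fun t => t) s
        = stepQ (valueSet φ) qr (s + c) (fun t => t) := by
    intro qr c s hc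
    simp only [ipExpQ, ipStepQ, stepQ_of_mem qr hc]
  have red0 : ∀ {c : ℚ} (s : ℚ), c ∈ valueSet φ →
      ipExp (valueSet φ) (fun _ => c) 1 (fun t => t) s = clamp (valueSet φ) (s + c) := by
    intro c s hc
    simp only [ipExp, ipStep, step_of_mem hc, step_id]
  -- length one from the start `0`: the inner rounding lands on values, which the outer step fixes
  have red' : ∀ (qr : ℚ → ℚ) (c : ℚ), ipExpQ (valueSet φ) qr (fun _ => c) 1 (fun t => t) 0
      = stepQ (valueSet φ) qr c (fun t => t) := by
    intro qr c
    simp only [ipExpQ, ipStepQ]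
    exact stepQ_congr_mem hne qr _ (fun a ha => by rw [zero_add, stepQ_of_mem qr ha])
  have red0' : ∀ c : ℚ, ipExp (valueSet φ) (fun _ => c) 1 (fun t => t) 0
      = clamp (valueSet φ) c := by
    intro c
    simp only [ipExp, ipStep]
    rw [step_congr (valueSet φ) c (f := fun a => step (valueSet φ) (0 + a) fun t => t)
        (g := fun t => t) (by simp only [zero_add, step_of_mem (up_mem hne _)])
        (by simp only [zero_add, step_of_mem (dn_mem hne _)]), step_id]
  rcases lt_max_iff.mp hN with hL | hP
  · obtain ⟨⟨hmm, hqm⟩, -, -, -, -⟩ := valueSet_tree_budget_sharp φ hE ht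
    have h1v := one_mem_valueSet φ (by omega) (by omega) hb
    obtain ⟨hA, hB, hC⟩ := valueSet_pair_biased_below φ hE ht hL
    refine ⟨fun _ => φ.quantum, fun _ => 1, fun _ => hqm, fun _ => h1v, -φ.maxRat, hmm, ?_, ?_, ?_⟩
    · simp only [mul_one]; rw [red _ _ hqm, red0 _ hqm]; exact hA
    · simp only [mul_one]; rw [red _ _ hqm, red0 _ hqm]; exact hB
    · simp only [mul_one]; rw [red _ _ hqm, red0 _ hqm]; exact hC
  · obtain ⟨a, ha, b, hb', hnd⟩ := valueSet_prod_not_dyadic_below φ hE h3 hm hn hP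
    obtain ⟨hA, hB, hC⟩ := stepQ_ABC_id_ne_of_not_dyadic hnd
    have h0 : (0 : ℚ) ∈ valueSet φ := by
      have h := MiniFloat.toRat_mem_valueSet (MiniFloat.zero φ)
      rwa [MiniFloat.toRat_zero] at h
    refine ⟨fun _ => a, fun _ => b, fun _ => ha, fun _ => hb', 0, h0, ?_, ?_, ?_⟩
    · rw [red', red0']; exact hA
    · rw [red', red0']; exact hB
    · rw [red', red0']; exact hC

/-! ### The four `iff` theorems -/

/-- **TREE threshold, iff, per rule.** Every summation tree with leaves in the value set has the
exact-SR law under rule `A` (resp. `B`, `C`) with `N` random bits iff `emaxCode − 1 ≤ N`. -/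
theorem tree_threshold_iff (φ : Format) (hE : 2 ≤ φ.emaxCode) (ht : 1 ≤ φ.topMan)
    (h3 : 3 ≤ φ.bias + φ.manBits) (N : ℕ) :
    ((∀ T : STree ℚ, LeavesIn (valueSet φ) T → ∀ f : ℚ → ℚ,
        treeExpQ (valueSet φ) (probAwayA N) T f = treeExp (valueSet φ) T f) ↔
      φ.emaxCode - 1 ≤ N) ∧
    ((∀ T : STree ℚ, LeavesIn (valueSet φ) T → ∀ f : ℚ → ℚ,
        treeExpQ (valueSet φ) (probAwayB N) T f = treeExp (valueSet φ) T f) ↔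
      φ.emaxCode - 1 ≤ N) ∧
    ((∀ T : STree ℚ, LeavesIn (valueSet φ) T → ∀ f : ℚ → ℚ,
        treeExpQ (valueSet φ) (probAwayC N) T f = treeExp (valueSet φ) T f) ↔
      φ.emaxCode - 1 ≤ N) := by
  obtain ⟨hT, -⟩ := valueSet_thresholds_exact φ _ _ _ _ _ rfl rfl rfl rfl rfl hE ht h3
  obtain ⟨⟨hmm, hqm⟩, -, -, -, -⟩ := valueSet_tree_budget_sharp φ hE ht
  have hLv : LeavesIn (valueSet φ) (node (leaf (-φ.maxRat)) (leaf φ.quantum)) := ⟨hmm, hqm⟩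
  -- the pair tree reduces to one step
  have nec : ∀ qr : ℚ → ℚ,
      stepQ (valueSet φ) qr (-φ.maxRat + φ.quantum) (fun t => t)
        ≠ clamp (valueSet φ) (-φ.maxRat + φ.quantum) →
      (∀ T : STree ℚ, LeavesIn (valueSet φ) T → ∀ f : ℚ → ℚ,
        treeExpQ (valueSet φ) qr T f = treeExp (valueSet φ) T f) → φ.emaxCode - 1 ≤ N := by
    intro qr hne h
    by_contra hlt
    have := h _ hLv (fun t => t)
    simp only [treeExpQ, treeExp, step_id] at this
    exact hne this
  refine ⟨⟨fun h => ?_, fun hL T hTl f => (hT hL T hTl f).1⟩,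
    ⟨fun h => ?_, fun hL T hTl f => (hT hL T hTl f).2.1⟩,
    ⟨fun h => ?_, fun hL T hTl f => (hT hL T hTl f).2.2⟩⟩
  · by_contra hlt
    exact hlt (nec _ (valueSet_pair_biased_below φ hE ht (not_le.mp hlt)).1 h)
  · by_contra hlt
    exact hlt (nec _ (valueSet_pair_biased_below φ hE ht (not_le.mp hlt)).2.1 h)
  · by_contra hlt
    exact hlt (nec _ (valueSet_pair_biased_below φ hE ht (not_le.mp hlt)).2.2 h)

/-- **IP1 threshold, iff, per rule.** Every one-stage inner product of format vectors (exact
products accumulated from any format start) has the exact-SR law under rule `A` (resp. `B`, `C`)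
with `N` bits iff `(emaxCode − 1) + (bias + m − 1) ≤ N`. -/
theorem ip1_threshold_iff (φ : Format) (hE : 2 ≤ φ.emaxCode) (ht : 1 ≤ φ.topMan)
    (h3 : 3 ≤ φ.bias + φ.manBits) (N : ℕ) :
    ((∀ {x y : ℕ → ℚ}, (∀ k, x k ∈ valueSet φ) → (∀ k, y k ∈ valueSet φ) →
        ∀ {s : ℚ}, s ∈ valueSet φ → ∀ (n : ℕ) (f : ℚ → ℚ),
        accExpQ (valueSet φ) (probAwayA N) (fun k => x k * y k) n f s
          = accExp (valueSet φ) (fun k => x k * y k) n f s) ↔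
      φ.emaxCode - 1 + (φ.bias + φ.manBits - 1) ≤ N) ∧
    ((∀ {x y : ℕ → ℚ}, (∀ k, x k ∈ valueSet φ) → (∀ k, y k ∈ valueSet φ) →
        ∀ {s : ℚ}, s ∈ valueSet φ → ∀ (n : ℕ) (f : ℚ → ℚ),
        accExpQ (valueSet φ) (probAwayB N) (fun k => x k * y k) n f s
          = accExp (valueSet φ) (fun k => x k * y k) n f s) ↔
      φ.emaxCode - 1 + (φ.bias + φ.manBits - 1) ≤ N) ∧
    ((∀ {x y : ℕ → ℚ}, (∀ k, x k ∈ valueSet φ) → (∀ k, y k ∈ valueSet φ) →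
        ∀ {s : ℚ}, s ∈ valueSet φ → ∀ (n : ℕ) (f : ℚ → ℚ),
        accExpQ (valueSet φ) (probAwayC N) (fun k => x k * y k) n f s
          = accExp (valueSet φ) (fun k => x k * y k) n f s) ↔
      φ.emaxCode - 1 + (φ.bias + φ.manBits - 1) ≤ N) := by
  obtain ⟨-, -, -, -, hI, -⟩ := valueSet_thresholds_exact φ _ _ _ _ _ rfl rfl rfl rfl rfl hE ht h3
  obtain ⟨⟨hmm, hqm⟩, -, -, -, -⟩ := valueSet_tree_budget_sharp φ hE ht
  have nec : ∀ qr : ℚ → ℚ,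
      stepQ (valueSet φ) qr (-φ.maxRat + φ.quantum * φ.quantum) (fun t => t)
        ≠ clamp (valueSet φ) (-φ.maxRat + φ.quantum * φ.quantum) →
      (∀ {x y : ℕ → ℚ}, (∀ k, x k ∈ valueSet φ) → (∀ k, y k ∈ valueSet φ) →
        ∀ {s : ℚ}, s ∈ valueSet φ → ∀ (n : ℕ) (f : ℚ → ℚ),
        accExpQ (valueSet φ) qr (fun k => x k * y k) n f s
          = accExp (valueSet φ) (fun k => x k * y k) n f s) →
      φ.emaxCode - 1 + (φ.bias + φ.manBits - 1) ≤ N := by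
    intro qr hne h
    by_contra hlt
    have := h (x := fun _ => φ.quantum) (y := fun _ => φ.quantum) (fun _ => hqm) (fun _ => hqm)
      hmm 1 (fun t => t)
    simp only [accExpQ, accExp, step_id] at this
    exact hne this
  have h1 : 1 ≤ φ.bias + φ.manBits := by omega
  refine ⟨⟨fun h => ?_, fun hL x y hx hy s hs n f => (hI hL hx hy hs n f).1⟩,
    ⟨fun h => ?_, fun hL x y hx hy s hs n f => (hI hL hx hy hs n f).2.1⟩,
    ⟨fun h => ?_, fun hL x y hx hy s hs n f => (hI hL hx hy hs n f).2.2⟩⟩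
  · by_contra hlt
    exact hlt (nec _ (valueSet_ip1_biased_below φ hE ht h1 (not_le.mp hlt)).1 h)
  · by_contra hlt
    exact hlt (nec _ (valueSet_ip1_biased_below φ hE ht h1 (not_le.mp hlt)).2.1 h)
  · by_contra hlt
    exact hlt (nec _ (valueSet_ip1_biased_below φ hE ht h1 (not_le.mp hlt)).2.2 h)

/-- **PROD threshold, iff.** Every exact product of two values has an `N`-bit dyadic up-probability
(so that it SR-rounds into the format exactly in law under every `N`-bit rule) iff
`max (m + 1) (bias + m − 1) ≤ N` — for `m ≥ 1`, `emaxCode + bias ≥ 4`. -/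
theorem prod_threshold_iff (φ : Format) (hE : 2 ≤ φ.emaxCode) (ht : 1 ≤ φ.topMan)
    (h3 : 3 ≤ φ.bias + φ.manBits) (hm : 1 ≤ φ.manBits) (hn : 4 ≤ φ.emaxCode + φ.bias) (N : ℕ) :
    (∀ a ∈ valueSet φ, ∀ b ∈ valueSet φ, Dyadic N (pUp (valueSet φ) (a * b))) ↔
      max (φ.manBits + 1) (φ.bias + φ.manBits - 1) ≤ N := by
  obtain ⟨-, -, hP, -⟩ := valueSet_thresholds_exact φ _ _ _ _ _ rfl rfl rfl rfl rfl hE ht h3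
  refine ⟨fun h => ?_, fun hle a ha b hb => dyadic_mono hle (hP a ha b hb)⟩
  by_contra hlt
  obtain ⟨a, ha, b, hb, hnd⟩ := valueSet_prod_not_dyadic_below φ hE h3 hm hn (not_le.mp hlt)
  exact hnd (h a ha b hb)

/-- **IP2 threshold, iff, per rule.** Every two-stage inner product of format vectors (each exact
product SR-rounded into the format, then accumulated, from any format start) has the exact-SR law
under rule `A` (resp. `B`, `C`) with `N` bits iff `max (emaxCode − 1) (max (m+1) (bias+m−1)) ≤ N`
— for `m ≥ 1`, `emaxCode + bias ≥ 4`, `bias ≤ emaxCode`. -/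
theorem ip2_threshold_iff (φ : Format) (hE : 2 ≤ φ.emaxCode) (ht : 1 ≤ φ.topMan)
    (h3 : 3 ≤ φ.bias + φ.manBits) (hm : 1 ≤ φ.manBits) (hn : 4 ≤ φ.emaxCode + φ.bias)
    (hb : φ.bias ≤ φ.emaxCode) (N : ℕ) :
    ((∀ {x y : ℕ → ℚ}, (∀ k, x k ∈ valueSet φ) → (∀ k, y k ∈ valueSet φ) →
        ∀ {s : ℚ}, s ∈ valueSet φ → ∀ (n : ℕ) (f : ℚ → ℚ),
        ipExpQ (valueSet φ) (probAwayA N) (fun k => x k * y k) n f s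
          = ipExp (valueSet φ) (fun k => x k * y k) n f s) ↔
      max (φ.emaxCode - 1) (max (φ.manBits + 1) (φ.bias + φ.manBits - 1)) ≤ N) ∧
    ((∀ {x y : ℕ → ℚ}, (∀ k, x k ∈ valueSet φ) → (∀ k, y k ∈ valueSet φ) →
        ∀ {s : ℚ}, s ∈ valueSet φ → ∀ (n : ℕ) (f : ℚ → ℚ),
        ipExpQ (valueSet φ) (probAwayB N) (fun k => x k * y k) n f s
          = ipExp (valueSet φ) (fun k => x k * y k) n f s) ↔
      max (φ.emaxCode - 1) (max (φ.manBits + 1) (φ.bias + φ.manBits - 1)) ≤ N) ∧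
    ((∀ {x y : ℕ → ℚ}, (∀ k, x k ∈ valueSet φ) → (∀ k, y k ∈ valueSet φ) →
        ∀ {s : ℚ}, s ∈ valueSet φ → ∀ (n : ℕ) (f : ℚ → ℚ),
        ipExpQ (valueSet φ) (probAwayC N) (fun k => x k * y k) n f s
          = ipExp (valueSet φ) (fun k => x k * y k) n f s) ↔
      max (φ.emaxCode - 1) (max (φ.manBits + 1) (φ.bias + φ.manBits - 1)) ≤ N) := by
  obtain ⟨-, -, -, -, -, -, hI⟩ :=
    valueSet_thresholds_exact φ _ _ _ _ _ rfl rfl rfl rfl rfl hE ht h3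
  refine ⟨⟨fun h => ?_, fun hL x y hx hy s hs n f => (hI hL hx hy hs n f).1⟩,
    ⟨fun h => ?_, fun hL x y hx hy s hs n f => (hI hL hx hy hs n f).2.1⟩,
    ⟨fun h => ?_, fun hL x y hx hy s hs n f => (hI hL hx hy hs n f).2.2⟩⟩
  · by_contra hlt
    obtain ⟨x, y, hx, hy, s, hs, hA, -, -⟩ :=
      valueSet_ip2_biased_below φ hE ht h3 hm hn hb (not_le.mp hlt)
    exact hA (h hx hy hs 1 _)
  · by_contra hlt
    obtain ⟨x, y, hx, hy, s, hs, -, hB, -⟩ :=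
      valueSet_ip2_biased_below φ hE ht h3 hm hn hb (not_le.mp hlt)
    exact hB (h hx hy hs 1 _)
  · by_contra hlt
    obtain ⟨x, y, hx, hy, s, hs, -, -, hC⟩ :=
      valueSet_ip2_biased_below φ hE ht h3 hm hn hb (not_le.mp hlt)
    exact hC (h hx hy hs 1 _)

end Summit.Ventures.CertifiedArithmetic.LowPrec.SR.LimitedBits
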